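import Summits.AtomisticToContinuum.HydrodynamicLimit.Theorems.CollisionIsometryCLTAdaptedWeightCLTBHEntropyBudgetDerivDom

/-!
# Entropy budget (stub `stub_entropyBudget`, line `block-h-dissipation-closure`, crux `AdaptedWeightCLT`,
stmt-AtomisticToContinuum-14868; `--supports`) — helper 8: the cell entropy and the mass-weighted cell
entropy along a free flight

For an admissible-type kernel (`ψ_N` smooth, `0 ≤ ψ_N ≤ A`, `‖∇ψ_N‖ ≤ L`), `h > 0`, `0 < δ ≤ 1`:
* NON-EMPTY CELL: `r ↦ H(f̂_{freeFlight r w, x})` is differentiable at `0` with derivative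
  `cW⁻¹ ∫ (1 + log f̂) dF dv` — differentiation under the integral sign
  (`hasDerivAt_integral_of_dominated_loc_of_deriv_le`) with the weight-uniform dominator of helper 7 on a
  time ball where the cell keeps half its mass (continuity of `cW` along the flight);
* EVERY CELL: the mass-weighted entropy `r ↦ cW · H(f̂)` is differentiable at `0` with derivative
  `D_x = (Σβ) H(f̂_x) + ∫ (1 + log f̂) dF dv` (product rule; on an EMPTY cell `D_x = 0` and the derivative
  is `0` because `cW ≥ 0` has a critical zero while `H(f̂)` stays bounded — a little-o argument);
* the velocity-uniform entropy bound `|H(f̂_x)| ≤ M(V,h,δ)` and continuity of `v ↦ dF(v)` used on the way.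
-/

namespace Summit.AtomisticToContinuum.HydrodynamicLimit.Theorems.BlockHDissipation

open scoped BigOperators Topology Classical MeasureTheory ENNReal InnerProductSpace
open Filter Set MeasureTheory Asymptotics
open Literature.Analysis.FluidPDE
open Literature.Analysis.FunctionSpaces (Torus.IsSmooth)
open Summit.AtomisticToContinuum.HydrodynamicLimit.Theorems.ContactSourceDuhamel (T3 V3 Cfg Vel Flow Flows)
open Literature.MathematicalPhysics.KineticTheory (localMaxwellian_pos localMaxwellian_nonneg continuous_localMaxwellian)

noncomputable section

namespace EntropyBudget

variable {N : ℕ} {ψ : ℕ → T3 → ℝ} {h δ : ℝ} (w : Cfg N) (x : T3)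


/-! ## Two uniform facts -/

/-- VELOCITY-UNIFORM ENTROPY BOUND: `|H(f̂_x)| ≤ |log (2πh²)^{-3/2}| + |log δ| + (3/2)(|log 2πh²| + |log 2πΘ|) + 3/2`,
`Θ = h² + (2V)²/3`. -/
theorem abs_cellEnt_le_unif (hψ : ∀ y, 0 ≤ ψ N y) (hh : 0 < h) (hδ : 0 < δ) (hδ1 : δ ≤ 1) {V : ℝ}
    (hV : ∀ i, ‖(w i).2‖ ≤ V) :
    |cellEnt N ψ h δ w x| ≤ |Real.log ((2 * Real.pi * h ^ 2) ^ (-(3 : ℝ) / 2))| + |Real.log δ| +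
      3 / 2 * (|Real.log (2 * Real.pi * h ^ 2)| + |Real.log (2 * Real.pi * (h ^ 2 + (2 * V) ^ 2 / 3))|) + 3 / 2 := by
  have h1 := abs_cellEnt_le (δ := δ) w x hψ hh hδ hδ1
  have h2 := abs_log_between hh (h2_le_theta w x hψ) (theta_le (h := h) w x hψ hV)
  linarith

/-- `v ↦ dF(v)` is continuous. -/
theorem continuous_dF : Continuous fun v => ((1 - δ) * (-(∑ i, Literature.Analysis.FunctionSpaces.Torus.fderiv (ψ N) ((w i).1 - x) (w i).2) *
    kde N ψ h w x (v) + ∑ i, Literature.Analysis.FunctionSpaces.Torus.fderiv (ψ N) ((w i).1 - x) (w i).2 * gauss h (w i).2 (v)) + δ *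
    (localMaxwellian 1 (cT N ψ w x + h ^ 2) (cU N ψ w x) (v) * ((-(∑ i, Literature.Analysis.FunctionSpaces.Torus.fderiv (ψ N) ((w i).1 - x) (w i).2) *
    cT N ψ w x + ∑ i, Literature.Analysis.FunctionSpaces.Torus.fderiv (ψ N) ((w i).1 - x) (w i).2 * (‖(w i).2 - cU N ψ w x‖ ^ 2 / 3)) * (‖(v) -
    cU N ψ w x‖ ^ 2 / (2 * (cT N ψ w x + h ^ 2) ^ 2) - 3 / (2 * (cT N ψ w x + h ^ 2))) + inner ℝ ((v) -
    cU N ψ w x) (-(∑ i, Literature.Analysis.FunctionSpaces.Torus.fderiv (ψ N) ((w i).1 - x) (w i).2) • cU N ψ w x +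
    ∑ i, Literature.Analysis.FunctionSpaces.Torus.fderiv (ψ N) ((w i).1 - x) (w i).2 • (w i).2) / (cT N ψ w x + h ^ 2)))) := by
  have hk : Continuous (kde N ψ h w x) := continuous_kde w x
  have hg : ∀ i, Continuous fun v => gauss h (w i).2 v := fun i => continuous_localMaxwellian 1 (h ^ 2) (w i).2
  have hM : Continuous fun v => localMaxwellian 1 (cT N ψ w x + h ^ 2) (cU N ψ w x) v := continuous_localMaxwellian 1 _ _
  have hq : Continuous fun v : V3 => ‖v - cU N ψ w x‖ ^ 2 := by fun_prop
  have hi : Continuous fun v : V3 => ⟪v - cU N ψ w x, (-(∑ i, Literature.Analysis.FunctionSpaces.Torus.fderiv (ψ N) ((w i).1 -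
      x) (w i).2) • cU N ψ w x + ∑ i, Literature.Analysis.FunctionSpaces.Torus.fderiv (ψ N) ((w i).1 - x) (w i).2 • (w i).2)⟫_ℝ := by fun_prop
  have hs : Continuous fun v => ∑ i, Literature.Analysis.FunctionSpaces.Torus.fderiv (ψ N) ((w i).1 - x) (w i).2 *
      gauss h (w i).2 v := continuous_finsetSum _ fun i _ => continuous_const.mul (hg i)
  exact ((continuous_const.mul ((continuous_const.mul hk).add hs))).add
    (continuous_const.mul (hM.mul (((continuous_const.mul ((hq.div_const _).sub continuous_const))).add
      (hi.div_const _))))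

/-- Along the flight a non-empty cell keeps half its mass for a while. -/
theorem eventually_half_mass (hψs : Torus.IsSmooth (ψ N)) (hS : 0 < cW N ψ w x) :
    ∃ ε > 0, ∀ s ∈ Metric.ball (0 : ℝ) ε, cW N ψ w x / 2 ≤ cW N ψ (freeFlight (Torus.geometry (Fin 3)) s w) x := by
  have hc := (continuous_cW_flight w x hψs).continuousAt (x := (0 : ℝ))
  have hev : ∀ᶠ s in 𝓝 (0 : ℝ), cW N ψ w x / 2 < cW N ψ (freeFlight (Torus.geometry (Fin 3)) s w) x := by
    refine hc.eventually (lt_mem_nhds ?_)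
    simp only [freeFlight_zero]
    linarith
  obtain ⟨ε, hε, hball⟩ := Metric.eventually_nhds_iff_ball.1 hev
  exact ⟨ε, hε, fun s hs => (hball s hs).le⟩

/-! ## The cell entropy along the flight (non-empty cell) -/

/-- **DIFFERENTIATION UNDER THE INTEGRAL SIGN.** In a non-empty cell,
`d/dr|₀ H(f̂_{freeFlight r w, x}) = cW⁻¹ ∫ (1 + log f̂(v)) dF(v) dv`. -/
theorem hasDerivAt_cellEnt (hψs : Torus.IsSmooth (ψ N)) (hψ : ∀ y, 0 ≤ ψ N y) {A L V : ℝ} (hA : ∀ y, ψ N y ≤ A)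
    (hL : ∀ y, ‖Literature.Analysis.FunctionSpaces.Torus.gradient (ψ N) y‖ ≤ L) (hV : ∀ i, ‖(w i).2‖ ≤ V)
    (hh : 0 < h) (hδ : 0 < δ) (hδ1 : δ ≤ 1) (hS : cW N ψ w x ≠ 0) :
    HasDerivAt (fun s => cellEnt N ψ h δ (freeFlight (Torus.geometry (Fin 3)) s w) x)
      ((cW N ψ w x)⁻¹ * ∫ v, (1 + Real.log (cellLaw N ψ h δ w x v)) * ((1 - δ) *
          (-(∑ i, Literature.Analysis.FunctionSpaces.Torus.fderiv (ψ N) ((w i).1 - x) (w i).2) * kde N ψ h w x (v) +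
          ∑ i, Literature.Analysis.FunctionSpaces.Torus.fderiv (ψ N) ((w i).1 - x) (w i).2 * gauss h (w i).2 (v)) + δ *
          (localMaxwellian 1 (cT N ψ w x + h ^ 2) (cU N ψ w x) (v) * ((-(∑ i, Literature.Analysis.FunctionSpaces.Torus.fderiv (ψ N) ((w i).1 -
          x) (w i).2) * cT N ψ w x + ∑ i, Literature.Analysis.FunctionSpaces.Torus.fderiv (ψ N) ((w i).1 - x) (w i).2 * (‖(w i).2 -
          cU N ψ w x‖ ^ 2 / 3)) * (‖(v) - cU N ψ w x‖ ^ 2 / (2 * (cT N ψ w x + h ^ 2) ^ 2) - 3 / (2 * (cT N ψ w x + h ^ 2))) + inner ℝ ((v) -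
          cU N ψ w x) (-(∑ i, Literature.Analysis.FunctionSpaces.Torus.fderiv (ψ N) ((w i).1 - x) (w i).2) • cU N ψ w x +
          ∑ i, Literature.Analysis.FunctionSpaces.Torus.fderiv (ψ N) ((w i).1 - x) (w i).2 • (w i).2) / (cT N ψ w x + h ^ 2))))) 0 := by
  have hSpos : 0 < cW N ψ w x := lt_of_le_of_ne (cW_nonneg w x hψ) (Ne.symm hS)
  obtain ⟨ε, hε, hball⟩ := eventually_half_mass w x hψs hSpos
  obtain ⟨bound, hbi, hb⟩ := exists_dominator (δ := δ) w x hψ hA hL hV hh hδ hδ1 (half_pos hSpos)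
  have hne : ∀ s ∈ Metric.ball (0 : ℝ) ε, cW N ψ (freeFlight (Torus.geometry (Fin 3)) s w) x ≠ 0 := fun s hs =>
    (lt_of_lt_of_le (half_pos hSpos) (hball s hs)).ne'
  have key := hasDerivAt_integral_of_dominated_loc_of_deriv_le (μ := (volume : Measure V3)) (x₀ := (0 : ℝ))
    (F := fun s v => cellLaw N ψ h δ (freeFlight (Torus.geometry (Fin 3)) s w) x v *
        Real.log (cellLaw N ψ h δ (freeFlight (Torus.geometry (Fin 3)) s w) x v))
    (F' := fun s v => (1 + Real.log (cellLaw N ψ h δ (freeFlight (Torus.geometry (Fin 3)) s w) x v)) *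
        ((cW N ψ (freeFlight (Torus.geometry (Fin 3)) s w) x)⁻¹ * ((1 - δ) *
        (-(∑ i, Literature.Analysis.FunctionSpaces.Torus.fderiv (ψ N) (((freeFlight (Torus.geometry (Fin 3)) s w) i).1 -
        x) ((freeFlight (Torus.geometry (Fin 3)) s w) i).2) * kde N ψ h (freeFlight (Torus.geometry (Fin 3)) s w) x (v) +
        ∑ i, Literature.Analysis.FunctionSpaces.Torus.fderiv (ψ N) (((freeFlight (Torus.geometry (Fin 3)) s w) i).1 -
        x) ((freeFlight (Torus.geometry (Fin 3)) s w) i).2 * gauss h ((freeFlight (Torus.geometry (Fin 3)) s w) i).2 (v)) + δ *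
        (localMaxwellian 1 (cT N ψ (freeFlight (Torus.geometry (Fin 3)) s w) x + h ^ 2) (cU N ψ (freeFlight (Torus.geometry (Fin 3)) s w) x) (v) *
        ((-(∑ i, Literature.Analysis.FunctionSpaces.Torus.fderiv (ψ N) (((freeFlight (Torus.geometry (Fin 3)) s w) i).1 -
        x) ((freeFlight (Torus.geometry (Fin 3)) s w) i).2) * cT N ψ (freeFlight (Torus.geometry (Fin 3)) s w) x +
        ∑ i, Literature.Analysis.FunctionSpaces.Torus.fderiv (ψ N) (((freeFlight (Torus.geometry (Fin 3)) s w) i).1 -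
        x) ((freeFlight (Torus.geometry (Fin 3)) s w) i).2 * (‖((freeFlight (Torus.geometry (Fin 3)) s w) i).2 -
        cU N ψ (freeFlight (Torus.geometry (Fin 3)) s w) x‖ ^ 2 / 3)) * (‖(v) - cU N ψ (freeFlight (Torus.geometry (Fin 3)) s w) x‖ ^ 2 / (2 *
        (cT N ψ (freeFlight (Torus.geometry (Fin 3)) s w) x + h ^ 2) ^ 2) - 3 / (2 * (cT N ψ (freeFlight (Torus.geometry (Fin 3)) s w) x + h ^ 2))) +
        inner ℝ ((v) -
        cU N ψ (freeFlight (Torus.geometry (Fin 3)) s w) x) (-(∑ i, Literature.Analysis.FunctionSpaces.Torus.fderiv (ψ N) (((freeFlight (Torus.geometry (Fin 3)) s w) i).1 -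
        x) ((freeFlight (Torus.geometry (Fin 3)) s w) i).2) • cU N ψ (freeFlight (Torus.geometry (Fin 3)) s w) x +
        ∑ i, Literature.Analysis.FunctionSpaces.Torus.fderiv (ψ N) (((freeFlight (Torus.geometry (Fin 3)) s w) i).1 -
        x) ((freeFlight (Torus.geometry (Fin 3)) s w) i).2 • ((freeFlight (Torus.geometry (Fin 3)) s w) i).2) / (cT N ψ (freeFlight (Torus.geometry (Fin 3)) s w) x +
        h ^ 2))))))
    (bound := bound) (Metric.ball_mem_nhds (0 : ℝ) hε) ?_ ?_ ?_ ?_ hbi ?_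
  · have e : (∫ v, (1 + Real.log (cellLaw N ψ h δ (freeFlight (Torus.geometry (Fin 3)) 0 w) x v)) *
      ((cW N ψ (freeFlight (Torus.geometry (Fin 3)) 0 w) x)⁻¹ * ((1 - δ) *
      (-(∑ i, Literature.Analysis.FunctionSpaces.Torus.fderiv (ψ N) (((freeFlight (Torus.geometry (Fin 3)) 0 w) i).1 -
      x) ((freeFlight (Torus.geometry (Fin 3)) 0 w) i).2) * kde N ψ h (freeFlight (Torus.geometry (Fin 3)) 0 w) x (v) +
      ∑ i, Literature.Analysis.FunctionSpaces.Torus.fderiv (ψ N) (((freeFlight (Torus.geometry (Fin 3)) 0 w) i).1 -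
      x) ((freeFlight (Torus.geometry (Fin 3)) 0 w) i).2 * gauss h ((freeFlight (Torus.geometry (Fin 3)) 0 w) i).2 (v)) + δ *
      (localMaxwellian 1 (cT N ψ (freeFlight (Torus.geometry (Fin 3)) 0 w) x + h ^ 2) (cU N ψ (freeFlight (Torus.geometry (Fin 3)) 0 w) x) (v) *
      ((-(∑ i, Literature.Analysis.FunctionSpaces.Torus.fderiv (ψ N) (((freeFlight (Torus.geometry (Fin 3)) 0 w) i).1 -
      x) ((freeFlight (Torus.geometry (Fin 3)) 0 w) i).2) * cT N ψ (freeFlight (Torus.geometry (Fin 3)) 0 w) x +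
      ∑ i, Literature.Analysis.FunctionSpaces.Torus.fderiv (ψ N) (((freeFlight (Torus.geometry (Fin 3)) 0 w) i).1 -
      x) ((freeFlight (Torus.geometry (Fin 3)) 0 w) i).2 * (‖((freeFlight (Torus.geometry (Fin 3)) 0 w) i).2 -
      cU N ψ (freeFlight (Torus.geometry (Fin 3)) 0 w) x‖ ^ 2 / 3)) * (‖(v) - cU N ψ (freeFlight (Torus.geometry (Fin 3)) 0 w) x‖ ^ 2 / (2 *
      (cT N ψ (freeFlight (Torus.geometry (Fin 3)) 0 w) x + h ^ 2) ^ 2) - 3 / (2 * (cT N ψ (freeFlight (Torus.geometry (Fin 3)) 0 w) x + h ^ 2))) +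
      inner ℝ ((v) -
      cU N ψ (freeFlight (Torus.geometry (Fin 3)) 0 w) x) (-(∑ i, Literature.Analysis.FunctionSpaces.Torus.fderiv (ψ N) (((freeFlight (Torus.geometry (Fin 3)) 0 w) i).1 -
      x) ((freeFlight (Torus.geometry (Fin 3)) 0 w) i).2) • cU N ψ (freeFlight (Torus.geometry (Fin 3)) 0 w) x +
      ∑ i, Literature.Analysis.FunctionSpaces.Torus.fderiv (ψ N) (((freeFlight (Torus.geometry (Fin 3)) 0 w) i).1 -
      x) ((freeFlight (Torus.geometry (Fin 3)) 0 w) i).2 • ((freeFlight (Torus.geometry (Fin 3)) 0 w) i).2) / (cT N ψ (freeFlight (Torus.geometry (Fin 3)) 0 w) x +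
      h ^ 2)))))) =
        (cW N ψ w x)⁻¹ * ∫ v, (1 + Real.log (cellLaw N ψ h δ w x v)) * ((1 - δ) *
            (-(∑ i, Literature.Analysis.FunctionSpaces.Torus.fderiv (ψ N) ((w i).1 - x) (w i).2) * kde N ψ h w x (v) +
            ∑ i, Literature.Analysis.FunctionSpaces.Torus.fderiv (ψ N) ((w i).1 - x) (w i).2 * gauss h (w i).2 (v)) + δ *
            (localMaxwellian 1 (cT N ψ w x + h ^ 2) (cU N ψ w x) (v) * ((-(∑ i, Literature.Analysis.FunctionSpaces.Torus.fderiv (ψ N) ((w i).1 -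
            x) (w i).2) * cT N ψ w x + ∑ i, Literature.Analysis.FunctionSpaces.Torus.fderiv (ψ N) ((w i).1 - x) (w i).2 * (‖(w i).2 -
            cU N ψ w x‖ ^ 2 / 3)) * (‖(v) - cU N ψ w x‖ ^ 2 / (2 * (cT N ψ w x + h ^ 2) ^ 2) - 3 / (2 * (cT N ψ w x + h ^ 2))) + inner ℝ ((v) -
            cU N ψ w x) (-(∑ i, Literature.Analysis.FunctionSpaces.Torus.fderiv (ψ N) ((w i).1 - x) (w i).2) • cU N ψ w x +
            ∑ i, Literature.Analysis.FunctionSpaces.Torus.fderiv (ψ N) ((w i).1 - x) (w i).2 • (w i).2) / (cT N ψ w x + h ^ 2)))) := by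
      simp only [freeFlight_zero]
      rw [← integral_const_mul]
      exact integral_congr_ae (Eventually.of_forall fun v => by ring)
    rw [← e]
    exact key.2
  · exact Eventually.of_forall fun s => ((continuous_cellLaw _ x).mul ((continuous_cellLaw _ x).log
      fun v => (cellLaw_pos _ x hψ hh hδ hδ1 v).ne')).aestronglyMeasurable
  · simpa only [freeFlight_zero] using integrable_cellLaw_mul_log w x hψ hh hδ hδ1
  · refine (Continuous.mul ?_ (continuous_const.mul (continuous_dF (h := h) (δ := δ) (freeFlight (Torus.geometry (Fin 3)) 0 w) x))).aestronglyMeasurable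
    exact continuous_const.add ((continuous_cellLaw _ x).log fun v => (cellLaw_pos _ x hψ hh hδ hδ1 v).ne')
  · refine Eventually.of_forall fun v s hs => ?_
    rw [Real.norm_eq_abs]
    exact hb (freeFlight (Torus.geometry (Fin 3)) s w) (fun i => rfl) (hball s hs) v
  · refine Eventually.of_forall fun v s hs => ?_
    have h1 := hasDerivAt_cellLaw (δ := δ) (freeFlight (Torus.geometry (Fin 3)) s w) x hψs hψ hh (hne s hs) v
    have h2 := hasDerivAt_cellLaw_mul_log (freeFlight (Torus.geometry (Fin 3)) s w) x hψ hh hδ hδ1 v h1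
    exact hasDerivAt_shift w (fun w' => cellLaw N ψ h δ w' x v * Real.log (cellLaw N ψ h δ w' x v)) h2

/-! ## The mass-weighted cell entropy along the flight (every cell) -/

/-- In an empty cell the transported density `D_x` vanishes. -/
theorem Dx_eq_zero_of_cW (hψ : ∀ y, 0 ≤ ψ N y) (hS : cW N ψ w x = 0) :
    (∑ i, Literature.Analysis.FunctionSpaces.Torus.fderiv (ψ N) ((w i).1 - x) (w i).2) * cellEnt N ψ h δ w x + ∫ v, (1 +
        Real.log (cellLaw N ψ h δ w x v)) * ((1 - δ) * (-(∑ i, Literature.Analysis.FunctionSpaces.Torus.fderiv (ψ N) ((w i).1 - x) (w i).2) *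
        kde N ψ h w x (v) + ∑ i, Literature.Analysis.FunctionSpaces.Torus.fderiv (ψ N) ((w i).1 - x) (w i).2 * gauss h (w i).2 (v)) + δ *
        (localMaxwellian 1 (cT N ψ w x + h ^ 2) (cU N ψ w x) (v) * ((-(∑ i, Literature.Analysis.FunctionSpaces.Torus.fderiv (ψ N) ((w i).1 -
        x) (w i).2) * cT N ψ w x + ∑ i, Literature.Analysis.FunctionSpaces.Torus.fderiv (ψ N) ((w i).1 - x) (w i).2 * (‖(w i).2 -
        cU N ψ w x‖ ^ 2 / 3)) * (‖(v) - cU N ψ w x‖ ^ 2 / (2 * (cT N ψ w x + h ^ 2) ^ 2) - 3 / (2 * (cT N ψ w x + h ^ 2))) + inner ℝ ((v) -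
        cU N ψ w x) (-(∑ i, Literature.Analysis.FunctionSpaces.Torus.fderiv (ψ N) ((w i).1 - x) (w i).2) • cU N ψ w x +
        ∑ i, Literature.Analysis.FunctionSpaces.Torus.fderiv (ψ N) ((w i).1 - x) (w i).2 • (w i).2) / (cT N ψ w x + h ^ 2)))) = 0 := by
  have hint : (∫ v, (1 + Real.log (cellLaw N ψ h δ w x v)) * ((1 - δ) * (-(∑ i, Literature.Analysis.FunctionSpaces.Torus.fderiv (ψ N) ((w i).1 -
      x) (w i).2) * kde N ψ h w x (v) + ∑ i, Literature.Analysis.FunctionSpaces.Torus.fderiv (ψ N) ((w i).1 - x) (w i).2 * gauss h (w i).2 (v)) + δ *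
      (localMaxwellian 1 (cT N ψ w x + h ^ 2) (cU N ψ w x) (v) * ((-(∑ i, Literature.Analysis.FunctionSpaces.Torus.fderiv (ψ N) ((w i).1 -
      x) (w i).2) * cT N ψ w x + ∑ i, Literature.Analysis.FunctionSpaces.Torus.fderiv (ψ N) ((w i).1 - x) (w i).2 * (‖(w i).2 -
      cU N ψ w x‖ ^ 2 / 3)) * (‖(v) - cU N ψ w x‖ ^ 2 / (2 * (cT N ψ w x + h ^ 2) ^ 2) - 3 / (2 * (cT N ψ w x + h ^ 2))) + inner ℝ ((v) -
      cU N ψ w x) (-(∑ i, Literature.Analysis.FunctionSpaces.Torus.fderiv (ψ N) ((w i).1 - x) (w i).2) • cU N ψ w x +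
      ∑ i, Literature.Analysis.FunctionSpaces.Torus.fderiv (ψ N) ((w i).1 - x) (w i).2 • (w i).2) / (cT N ψ w x + h ^ 2))))) = 0 := by
    refine integral_eq_zero_of_ae (Eventually.of_forall fun v => ?_)
    simp only [Pi.zero_apply]
    rw [dF_eq_zero_of_cW w x hψ hS v, mul_zero]
  rw [hint, sum_dcw_eq_zero_of_cW w x hψ hS, zero_mul, zero_add]

/-- **THE MASS-WEIGHTED CELL ENTROPY IS DIFFERENTIABLE ALONG THE FLIGHT**, in every cell:
`d/dr|₀ (cW · H(f̂)) = D_x = (Σβ) H(f̂_x) + ∫ (1 + log f̂) dF dv`. -/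
theorem hasDerivAt_cW_mul_cellEnt (hψs : Torus.IsSmooth (ψ N)) (hψ : ∀ y, 0 ≤ ψ N y) {A L V : ℝ}
    (hA : ∀ y, ψ N y ≤ A) (hL : ∀ y, ‖Literature.Analysis.FunctionSpaces.Torus.gradient (ψ N) y‖ ≤ L)
    (hV : ∀ i, ‖(w i).2‖ ≤ V) (hh : 0 < h) (hδ : 0 < δ) (hδ1 : δ ≤ 1) :
    HasDerivAt (fun s => cW N ψ (freeFlight (Torus.geometry (Fin 3)) s w) x * cellEnt N ψ h δ (freeFlight (Torus.geometry (Fin 3)) s w) x)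
      ((∑ i, Literature.Analysis.FunctionSpaces.Torus.fderiv (ψ N) ((w i).1 - x) (w i).2) * cellEnt N ψ h δ w x + ∫ v, (1 +
          Real.log (cellLaw N ψ h δ w x v)) * ((1 - δ) * (-(∑ i, Literature.Analysis.FunctionSpaces.Torus.fderiv (ψ N) ((w i).1 - x) (w i).2) *
          kde N ψ h w x (v) + ∑ i, Literature.Analysis.FunctionSpaces.Torus.fderiv (ψ N) ((w i).1 - x) (w i).2 * gauss h (w i).2 (v)) + δ *
          (localMaxwellian 1 (cT N ψ w x + h ^ 2) (cU N ψ w x) (v) * ((-(∑ i, Literature.Analysis.FunctionSpaces.Torus.fderiv (ψ N) ((w i).1 -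
          x) (w i).2) * cT N ψ w x + ∑ i, Literature.Analysis.FunctionSpaces.Torus.fderiv (ψ N) ((w i).1 - x) (w i).2 * (‖(w i).2 -
          cU N ψ w x‖ ^ 2 / 3)) * (‖(v) - cU N ψ w x‖ ^ 2 / (2 * (cT N ψ w x + h ^ 2) ^ 2) - 3 / (2 * (cT N ψ w x + h ^ 2))) + inner ℝ ((v) -
          cU N ψ w x) (-(∑ i, Literature.Analysis.FunctionSpaces.Torus.fderiv (ψ N) ((w i).1 - x) (w i).2) • cU N ψ w x +
          ∑ i, Literature.Analysis.FunctionSpaces.Torus.fderiv (ψ N) ((w i).1 - x) (w i).2 • (w i).2) / (cT N ψ w x + h ^ 2))))) 0 := by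
  by_cases hS : cW N ψ w x = 0
  · -- empty cell: a critical zero of `cW ≥ 0` against a bounded entropy
    rw [Dx_eq_zero_of_cW w x hψ hS]
    have hg : HasDerivAt (fun s => cW N ψ (freeFlight (Torus.geometry (Fin 3)) s w) x) 0 0 := by
      have := hasDerivAt_cW w x hψs
      rwa [sum_dcw_eq_zero_of_cW w x hψ hS] at this
    set M : ℝ := |Real.log ((2 * Real.pi * h ^ 2) ^ (-(3 : ℝ) / 2))| + |Real.log δ| +
      3 / 2 * (|Real.log (2 * Real.pi * h ^ 2)| + |Real.log (2 * Real.pi * (h ^ 2 + (2 * V) ^ 2 / 3))|) + 3 / 2 with hM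
    rw [hasDerivAt_iff_isLittleO] at hg ⊢
    have hO : (fun s => cW N ψ (freeFlight (Torus.geometry (Fin 3)) s w) x * cellEnt N ψ h δ (freeFlight (Torus.geometry (Fin 3)) s w) x -
        cW N ψ (freeFlight (Torus.geometry (Fin 3)) 0 w) x * cellEnt N ψ h δ (freeFlight (Torus.geometry (Fin 3)) 0 w) x -
        (s - 0) • (0 : ℝ)) =O[𝓝 0] (fun s => cW N ψ (freeFlight (Torus.geometry (Fin 3)) s w) x - cW N ψ (freeFlight (Torus.geometry (Fin 3)) 0 w) x -
            (s - 0) • (0 : ℝ)) := by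
      refine IsBigO.of_bound M (Eventually.of_forall fun s => ?_)
      simp only [freeFlight_zero, hS, zero_mul, sub_zero, smul_zero, norm_mul, Real.norm_eq_abs]
      rw [mul_comm]
      exact mul_le_mul_of_nonneg_right (abs_cellEnt_le_unif (freeFlight (Torus.geometry (Fin 3)) s w) x hψ hh hδ hδ1 hV) (abs_nonneg _)
    exact hO.trans_isLittleO hg
  · have hd := (hasDerivAt_cW w x hψs).fun_mul (hasDerivAt_cellEnt w x hψs hψ hA hL hV hh hδ hδ1 hS)
    refine hd.congr_deriv ?_
    simp only [freeFlight_zero]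
    rw [mul_inv_cancel_left₀ hS]

end EntropyBudget

/-- Registered anchor of this helper file (`--supports stmt-AtomisticToContinuum-14868`, helper of
`stub_entropyBudget`): the velocity-uniform bound of the regularised cell entropy. -/
theorem bhEntropyBudget_derivEnt_anchor : ∀ (N : ℕ) (ψ : ℕ → T3 → ℝ) (h δ : ℝ) (w : Cfg N) (x : T3) (V : ℝ), (∀ y, 0 ≤ ψ N y) → 0 < h → 0 < δ → δ ≤
    1 → (∀ i, ‖(w i).2‖ ≤ V) → |cellEnt N ψ h δ w x| ≤ |Real.log ((2 * Real.pi * h ^ 2) ^ (-(3 : ℝ) / 2))| + |Real.log δ| + 3 / 2 * (|Real.log (2 *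
    Real.pi * h ^ 2)| + |Real.log (2 * Real.pi * (h ^ 2 + (2 * V) ^ 2 / 3))|) + 3 / 2 :=
  fun _ _ _ _ w x _ hψ hh hδ hδ1 hV => EntropyBudget.abs_cellEnt_le_unif w x hψ hh hδ hδ1 hV

end

end Summit.AtomisticToContinuum.HydrodynamicLimit.Theorems.BlockHDissipation
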